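import Mathlib
import Summits.Ventures.HodgeRepro2.T5UnitaryCoframe
import Summits.Ventures.HodgeRepro2.T5ComplexOrientation

/-!
# T5UnitaryCoframeOrientation — the unitary real frame is positively oriented

Tier-5 support of seat p6 (cell pub-hodge-repro2): the last clause of the first sentence of the
proof of Lemma H2.1 (route/T5-N1-hodge-p6.md) — «`e₁, Ie₁, e₂, Ie₂` is a POSITIVELY ORIENTED
`g`-orthonormal real basis».  `T5UnitaryCoframe` gives the real frame of a unitary pair and its
`Re h`-orthonormality; `T5ComplexOrientation` gives the complex orientation as the orientation
of the real frame of ANY ℂ-basis.  Here the two are matched: the unitary pair is a ℂ-basis of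
the plane, its `T5UnitaryCoframe.realFrame` is the `T5ComplexOrientation.realBasis` of that
ℂ-basis up to the re-indexing `(k, s) ↦ (if s then 1 else 0, k)`, hence its orientation is the
complex orientation.  Bookkeeping only.
-/

namespace Summit.Ventures.HodgeRepro2.T5UnitaryCoframeOrientation

open Module

variable {E : Type*} [NormedAddCommGroup E] [InnerProductSpace ℂ E]

/-- The index re-labelling between the two real frames: `(k, s) ↦ (if s then 1 else 0, k)`. -/
def reindexEquiv : Fin 2 × Bool ≃ Fin 2 × Fin 2 where
  toFun p := (if p.2 then 1 else 0, p.1)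
  invFun q := (q.2, q.1 = 1)
  left_inv p := by
    obtain ⟨k, s⟩ := p
    cases s <;> simp
  right_inv q := by
    obtain ⟨s, k⟩ := q
    fin_cases s <;> simp

/-- The unitary pair as a ℂ-basis of the plane. -/
noncomputable def unitaryBasis (v : Fin 2 → E) (hv : Orthonormal ℂ v) (h : finrank ℂ E = 2) :
    Basis (Fin 2) ℂ E :=
  basisOfOrthonormalOfCardEqFinrank hv (by rw [Fintype.card_fin, h])

/-- The ℂ-basis is the pair. -/
theorem coe_unitaryBasis (v : Fin 2 → E) (hv : Orthonormal ℂ v) (h : finrank ℂ E = 2) :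
    (unitaryBasis v hv h : Fin 2 → E) = v :=
  coe_basisOfOrthonormalOfCardEqFinrank _ _

/-- The unitary real frame, re-indexed, is the real frame of the ℂ-basis `unitaryBasis`. -/
theorem realFrame_eq (v : Fin 2 → E) (hv : Orthonormal ℂ v) (h : finrank ℂ E = 2)
    (q : Fin 2 × Fin 2) :
    T5UnitaryCoframe.realFrame v (reindexEquiv.symm q) =
      T5ComplexOrientation.realBasis (unitaryBasis v hv h) q := by
  obtain ⟨s, k⟩ := q
  rw [T5ComplexOrientation.realBasis_apply, coe_unitaryBasis]
  fin_cases s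
  · simp [reindexEquiv, T5UnitaryCoframe.realFrame, T5UnitaryCoframe.twist, Complex.coe_basisOneI]
  · simp [reindexEquiv, T5UnitaryCoframe.realFrame, T5UnitaryCoframe.twist, Complex.coe_basisOneI]

/-- As bases: the re-indexed unitary real basis IS the complex-orientation real basis. -/
theorem realBasis_reindex_eq (v : Fin 2 → E) (hv : Orthonormal ℂ v) (h : finrank ℂ E = 2) :
    (T5UnitaryCoframe.realBasis v hv h).reindex reindexEquiv =
      T5ComplexOrientation.realBasis (unitaryBasis v hv h) := by
  apply Basis.eq_of_apply_eq
  intro q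
  rw [Basis.reindex_apply, T5UnitaryCoframe.coe_realBasis, realFrame_eq v hv h q]

/-- **H2.1, «positively oriented».** The orientation of the unitary real frame `e₁, Ie₁, e₂, Ie₂`
(transported along the re-indexing) is the complex orientation. -/
theorem orientation_realBasis_eq_complexOrientation (v : Fin 2 → E) (hv : Orthonormal ℂ v)
    (h : finrank ℂ E = 2) :
    Orientation.reindex ℝ E reindexEquiv (T5UnitaryCoframe.realBasis v hv h).orientation =
      T5ComplexOrientation.complexOrientation (unitaryBasis v hv h) := by
  rw [← Basis.orientation_reindex, realBasis_reindex_eq]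
  rfl

/-- The same against ANY ℂ-basis `b` used to define the complex orientation. -/
theorem orientation_realBasis_eq_complexOrientation' (v : Fin 2 → E) (hv : Orthonormal ℂ v)
    (h : finrank ℂ E = 2) (b : Basis (Fin 2) ℂ E) :
    Orientation.reindex ℝ E reindexEquiv (T5UnitaryCoframe.realBasis v hv h).orientation =
      T5ComplexOrientation.complexOrientation b := by
  rw [orientation_realBasis_eq_complexOrientation, T5ComplexOrientation.complexOrientation_eq]

end Summit.Ventures.HodgeRepro2.T5UnitaryCoframeOrientation
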